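import Summits.SmoothPoincare4.SmoothPoincare4.Theorems.SymplecticOrigamiGromovRecognitionRelEndStubCapModelX4

/-!
# Wedge cap for `GromovRecognitionRelEnd` — the complex structure `JX` and the form `ωX` of `X`
(stub `stub_capModel` of line `cross-cap-laurent`, crux `SymplecticOrigami.GromovRecognitionRelEnd`,
item stmt-SmoothPoincare4-11009)

The gluing `M ⇀ Cap`, `x ↦ ofCoord (ψ x)`, is `(J, JCap)`-holomorphic on its source (`hol_X`:
beyond `R₁`, `dψ ∘ J = (i⊕i) ∘ dψ` by Stub 2, the chart maps `inv1`, `inv2` are holomorphic and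
`JCap` is `i ⊕ i` in the charts) and pulls the cap form back to the modified form
(`compat_X`: `inv1^* ΩV = ΩM`, `inv2^* ΩH = ΩM`). Hence (generic gluing files) the almost complex
structure `JX` of `X = M ∪ Cap` extending `J` and `JCap`, and the closed form `ωX` extending `sfMod`
and `βCap`, which tames `JX`.
-/

noncomputable section

-- the registered namespace `Summit.SmoothPoincare4.SmoothPoincare4.Theorems…` repeats a component
set_option linter.dupNamespace false

open scoped Manifold ContDiff Topology
open Set Function Filter TopologicalSpace Literature.Geometry.Kaehler Literature.Geometry.Symplectic
  Literature.Topology.FourManifolds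

namespace Summit.SmoothPoincare4.SmoothPoincare4.Theorems.GromovRecognitionRelEnd.CrossCapLaurent

namespace CapModel

/-- Model space `ℝ⁴ = ℂ²` (coordinates `0,1` = `z₁`, `2,3` = `z₂`). -/
local notation "E4" => EuclideanSpace ℝ (Fin 4)

/-! ## Small congruence lemmas -/

/-- An almost complex structure evaluated at propositionally equal points. [folklore] -/
theorem acs_congr_point {N : Type*} [TopologicalSpace N] [ChartedSpace E4 N] [IsManifold 𝓘(ℝ, E4) ∞ N]
    (J' : AlmostComplexStructure 𝓘(ℝ, E4) ∞ N) {y y' : N} (h : y = y') (u : E4) : J' y u = J' y' u := by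
  subst h; rfl

/-- Pull-backs along two maps with the same germ agree. [folklore] -/
theorem pullback_congr_map {M' N : Type*} [TopologicalSpace M'] [ChartedSpace E4 M'] [TopologicalSpace N]
    [ChartedSpace E4 N] (γ : MForm 𝓘(ℝ, E4) N ℝ 2) {f g : M' → N} {x : M'} (h : f =ᶠ[𝓝 x] g) :
    γ.pullback 𝓘(ℝ, E4) f x = γ.pullback 𝓘(ℝ, E4) g x := by
  ext u
  rw [MForm.pullback_apply, MForm.pullback_apply, h.mfderiv_eq]
  exact MForm.congr_point γ h.self_of_nhds _

/-- Pull-backs of two forms agreeing at the image point agree. [folklore] -/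
theorem pullback_congr_form {M' N : Type*} [TopologicalSpace M'] [ChartedSpace E4 M'] [TopologicalSpace N]
    [ChartedSpace E4 N] {γ₁ γ₂ : MForm 𝓘(ℝ, E4) N ℝ 2} {f : M' → N} {x : M'} (h : γ₁ (f x) = γ₂ (f x)) :
    γ₁.pullback 𝓘(ℝ, E4) f x = γ₂.pullback 𝓘(ℝ, E4) f x := by
  ext u
  rw [MForm.pullback_apply, MForm.pullback_apply, h]

variable {R₁ : ℝ} [hR : Fact (0 < R₁)]

/-! ## The cap structures read in the charts -/

/-- **`JCap` is `i ⊕ i` in the `V`-chart.** [folklore] -/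
theorem JCap_κV (b : OV R₁) (u : E4) :
    JCap R₁ (κV b) (mfderiv 𝓘(ℝ, E4) 𝓘(ℝ, E4) (κV : OV R₁ → Cap R₁) b u) =
      mfderiv 𝓘(ℝ, E4) 𝓘(ℝ, E4) (κV : OV R₁ → Cap R₁) b (I4 u) := by
  have h1 : MDifferentiableAt 𝓘(ℝ, E4) 𝓘(ℝ, E4) (dC1 R₁).inl (jV₁ b) :=
    ((dC1 R₁).contMDiff_inl _).mdifferentiableAt (by simp)
  have h2 : MDifferentiableAt 𝓘(ℝ, E4) 𝓘(ℝ, E4) (jV₁ : OV R₁ → C₁ R₁) b :=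
    ((dVH R₁).contMDiff_inl _).mdifferentiableAt (by simp)
  have e : ∀ u : E4, mfderiv 𝓘(ℝ, E4) 𝓘(ℝ, E4) (κV : OV R₁ → Cap R₁) b u =
      mfderiv 𝓘(ℝ, E4) 𝓘(ℝ, E4) (dC1 R₁).inl (jV₁ b) (mfderiv 𝓘(ℝ, E4) 𝓘(ℝ, E4) jV₁ b u) :=
    fun u => congrArg (fun L : E4 →L[ℝ] E4 => L u) (mfderiv_comp b h1 h2)
  rw [e, e]
  show JCap R₁ ((dC1 R₁).inl (jV₁ b)) _ = _
  rw [JCap, GlueJ.glueACS_inl, J₁, GlueJ.glueACS_inl, JV_apply]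

/-- **`JCap` is `i ⊕ i` in the `H`-chart.** [folklore] -/
theorem JCap_κH (b : OH R₁) (u : E4) :
    JCap R₁ (κH b) (mfderiv 𝓘(ℝ, E4) 𝓘(ℝ, E4) (κH : OH R₁ → Cap R₁) b u) =
      mfderiv 𝓘(ℝ, E4) 𝓘(ℝ, E4) (κH : OH R₁ → Cap R₁) b (I4 u) := by
  have h1 : MDifferentiableAt 𝓘(ℝ, E4) 𝓘(ℝ, E4) (dC1 R₁).inl (jH₁ b) :=
    ((dC1 R₁).contMDiff_inl _).mdifferentiableAt (by simp)
  have h2 : MDifferentiableAt 𝓘(ℝ, E4) 𝓘(ℝ, E4) (jH₁ : OH R₁ → C₁ R₁) b :=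
    ((dVH R₁).contMDiff_inr _).mdifferentiableAt (by simp)
  have e : ∀ u : E4, mfderiv 𝓘(ℝ, E4) 𝓘(ℝ, E4) (κH : OH R₁ → Cap R₁) b u =
      mfderiv 𝓘(ℝ, E4) 𝓘(ℝ, E4) (dC1 R₁).inl (jH₁ b) (mfderiv 𝓘(ℝ, E4) 𝓘(ℝ, E4) jH₁ b u) :=
    fun u => congrArg (fun L : E4 →L[ℝ] E4 => L u) (mfderiv_comp b h1 h2)
  rw [e, e]
  show JCap R₁ ((dC1 R₁).inl (jH₁ b)) _ = _
  rw [JCap, GlueJ.glueACS_inl, J₁, GlueJ.glueACS_inr, JH_apply]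

/-- **`JCap` is `i ⊕ i` in the corner chart.** [folklore] -/
theorem JCap_κC (c : OC R₁) (u : E4) :
    JCap R₁ (κC c) (mfderiv 𝓘(ℝ, E4) 𝓘(ℝ, E4) (κC : OC R₁ → Cap R₁) c u) =
      mfderiv 𝓘(ℝ, E4) 𝓘(ℝ, E4) (κC : OC R₁ → Cap R₁) c (I4 u) := by
  show JCap R₁ ((dC1 R₁).inr c) (mfderiv 𝓘(ℝ, E4) 𝓘(ℝ, E4) (dC1 R₁).inr c u) = _
  rw [JCap, GlueJ.glueACS_inr, JC_apply]

/-- **`βCap` is `ΩV` in the `V`-chart.** [folklore] -/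
theorem βCap_pullback_κV (b : OV R₁) : (βCap R₁).pullback 𝓘(ℝ, E4) (κV : OV R₁ → Cap R₁) b = βV R₁ b := by
  have h1 : MDifferentiableAt 𝓘(ℝ, E4) 𝓘(ℝ, E4) (dC1 R₁).inl (jV₁ b) :=
    ((dC1 R₁).contMDiff_inl _).mdifferentiableAt (by simp)
  have h2 : MDifferentiableAt 𝓘(ℝ, E4) 𝓘(ℝ, E4) (jV₁ : OV R₁ → C₁ R₁) b :=
    ((dVH R₁).contMDiff_inl _).mdifferentiableAt (by simp)
  have e : ((βCap R₁).pullback 𝓘(ℝ, E4) (dC1 R₁).inl) (jV₁ b) = β₁ R₁ (jV₁ b) :=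
    GlueF.glueForm_pullback_inl (dC1 R₁) (jV₁ b)
  rw [show (κV : OV R₁ → Cap R₁) = (dC1 R₁).inl ∘ jV₁ from rfl, pullback_comp_pt _ h1 h2,
    pullback_congr_form e, β₁, GlueF.glueForm_pullback_inl]

/-- **`βCap` is `ΩH` in the `H`-chart.** [folklore] -/
theorem βCap_pullback_κH (b : OH R₁) : (βCap R₁).pullback 𝓘(ℝ, E4) (κH : OH R₁ → Cap R₁) b = βH R₁ b := by
  have h1 : MDifferentiableAt 𝓘(ℝ, E4) 𝓘(ℝ, E4) (dC1 R₁).inl (jH₁ b) :=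
    ((dC1 R₁).contMDiff_inl _).mdifferentiableAt (by simp)
  have h2 : MDifferentiableAt 𝓘(ℝ, E4) 𝓘(ℝ, E4) (jH₁ : OH R₁ → C₁ R₁) b :=
    ((dVH R₁).contMDiff_inr _).mdifferentiableAt (by simp)
  have e : ((βCap R₁).pullback 𝓘(ℝ, E4) (dC1 R₁).inl) (jH₁ b) = β₁ R₁ (jH₁ b) :=
    GlueF.glueForm_pullback_inl (dC1 R₁) (jH₁ b)
  rw [show (κH : OH R₁ → Cap R₁) = (dC1 R₁).inl ∘ jH₁ from rfl, pullback_comp_pt _ h1 h2,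
    pullback_congr_form e, β₁, GlueF.glueForm_pullback_inr _ compat_VH]

/-! ## The chart maps `κV ∘ mkV ∘ inv1`, `κH ∘ mkH ∘ inv2` from the end coordinates -/

/-- The `V`-chart map from end coordinates. [folklore] -/
def FV : E4 → Cap R₁ := κV ∘ (toOpens (OV R₁) oV ∘ inv1)
/-- The `H`-chart map from end coordinates. [folklore] -/
def FH : E4 → Cap R₁ := κH ∘ (toOpens (OH R₁) oH ∘ inv2)

/-- `ofCoord = FV` near a point with `|z₁| > R₁`. [folklore] -/
theorem ofCoord_eventuallyEq_FV {w : E4} (h1 : R₁ ^ 2 < r1 w) : (ofCoord : E4 → Cap R₁) =ᶠ[𝓝 w] FV := by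
  filter_upwards [(isOpen_lt continuous_const continuous_r1).mem_nhds h1] with w' hw'
  exact ofCoord_of_r1 hw'
/-- `ofCoord = FH` near a point with `|z₂| > R₁`. [folklore] -/
theorem ofCoord_eventuallyEq_FH {w : E4} (h2 : R₁ ^ 2 < r2 w) : (ofCoord : E4 → Cap R₁) =ᶠ[𝓝 w] FH := by
  filter_upwards [(isOpen_lt continuous_const continuous_r2).mem_nhds h2] with w' hw'
  exact ofCoord_of_r2 hw'

/-- The inner map of `FV` is differentiable with derivative `D(inv1)`. [folklore] -/
theorem mfderiv_mkV_inv1 {w : E4} (h1 : R₁ ^ 2 < r1 w) :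
    MDifferentiableAt 𝓘(ℝ, E4) 𝓘(ℝ, E4) (toOpens (OV R₁) oV ∘ inv1) w ∧
      ∀ u : E4, mfderiv 𝓘(ℝ, E4) 𝓘(ℝ, E4) (toOpens (OV R₁) oV ∘ inv1) w u = fderiv ℝ inv1 w u := by
  have hm : inv1 w ∈ OV R₁ := r1_inv1_lt hR.out h1
  have ha : MDifferentiableAt 𝓘(ℝ, E4) 𝓘(ℝ, E4) (toOpens (OV R₁) oV) (inv1 w) :=
    (contMDiffAt_toOpens hm).mdifferentiableAt (by simp)
  have hb : MDifferentiableAt 𝓘(ℝ, E4) 𝓘(ℝ, E4) inv1 w :=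
    (contDiffAt_inv1 (r1_ne_zero_of_sq_lt h1)).differentiableAt (by simp) |>.mdifferentiableAt
  refine ⟨ha.comp w hb, fun u => ?_⟩
  rw [mfderiv_comp w ha hb]
  show mfderiv 𝓘(ℝ, E4) 𝓘(ℝ, E4) (toOpens (OV R₁) oV) (inv1 w) (mfderiv 𝓘(ℝ, E4) 𝓘(ℝ, E4) inv1 w u) = _
  rw [mfderiv_toOpens_apply hm, mfderiv_eq_fderiv]
  rfl

/-- The inner map of `FH` is differentiable with derivative `D(inv2)`. [folklore] -/
theorem mfderiv_mkH_inv2 {w : E4} (h2 : R₁ ^ 2 < r2 w) :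
    MDifferentiableAt 𝓘(ℝ, E4) 𝓘(ℝ, E4) (toOpens (OH R₁) oH ∘ inv2) w ∧
      ∀ u : E4, mfderiv 𝓘(ℝ, E4) 𝓘(ℝ, E4) (toOpens (OH R₁) oH ∘ inv2) w u = fderiv ℝ inv2 w u := by
  have hm : inv2 w ∈ OH R₁ := r2_inv2_lt hR.out h2
  have ha : MDifferentiableAt 𝓘(ℝ, E4) 𝓘(ℝ, E4) (toOpens (OH R₁) oH) (inv2 w) :=
    (contMDiffAt_toOpens hm).mdifferentiableAt (by simp)
  have hb : MDifferentiableAt 𝓘(ℝ, E4) 𝓘(ℝ, E4) inv2 w :=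
    (contDiffAt_inv2 (r2_ne_zero_of_sq_lt h2)).differentiableAt (by simp) |>.mdifferentiableAt
  refine ⟨ha.comp w hb, fun u => ?_⟩
  rw [mfderiv_comp w ha hb]
  show mfderiv 𝓘(ℝ, E4) 𝓘(ℝ, E4) (toOpens (OH R₁) oH) (inv2 w) (mfderiv 𝓘(ℝ, E4) 𝓘(ℝ, E4) inv2 w u) = _
  rw [mfderiv_toOpens_apply hm, mfderiv_eq_fderiv]
  rfl

/-- `κV` is differentiable. [folklore] -/
theorem mdifferentiableAt_κV (b : OV R₁) : MDifferentiableAt 𝓘(ℝ, E4) 𝓘(ℝ, E4) (κV : OV R₁ → Cap R₁) b :=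
  ((((dC1 R₁).contMDiff_inl _).comp b ((dVH R₁).contMDiff_inl b))).mdifferentiableAt (by simp)
/-- `κH` is differentiable. [folklore] -/
theorem mdifferentiableAt_κH (b : OH R₁) : MDifferentiableAt 𝓘(ℝ, E4) 𝓘(ℝ, E4) (κH : OH R₁ → Cap R₁) b :=
  ((((dC1 R₁).contMDiff_inl _).comp b ((dVH R₁).contMDiff_inr b))).mdifferentiableAt (by simp)

/-- **Differential of `FV`**: `d(FV)_w u = dκV (D(inv1)_w u)`. [folklore] -/
theorem mfderiv_FV {w : E4} (h1 : R₁ ^ 2 < r1 w) :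
    MDifferentiableAt 𝓘(ℝ, E4) 𝓘(ℝ, E4) (FV : E4 → Cap R₁) w ∧ ∀ u : E4,
      mfderiv 𝓘(ℝ, E4) 𝓘(ℝ, E4) (FV : E4 → Cap R₁) w u =
        mfderiv 𝓘(ℝ, E4) 𝓘(ℝ, E4) (κV : OV R₁ → Cap R₁) (mkV (inv1 w)) (fderiv ℝ inv1 w u) := by
  obtain ⟨hd, he⟩ := mfderiv_mkV_inv1 h1
  have hκ := mdifferentiableAt_κV (R₁ := R₁) (mkV (inv1 w))
  refine ⟨hκ.comp w hd, fun u => ?_⟩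
  rw [FV, mfderiv_comp w hκ hd]
  show mfderiv 𝓘(ℝ, E4) 𝓘(ℝ, E4) κV (mkV (inv1 w)) (mfderiv 𝓘(ℝ, E4) 𝓘(ℝ, E4)
    (toOpens (OV R₁) oV ∘ inv1) w u) = _
  rw [he]

/-- **Differential of `FH`**: `d(FH)_w u = dκH (D(inv2)_w u)`. [folklore] -/
theorem mfderiv_FH {w : E4} (h2 : R₁ ^ 2 < r2 w) :
    MDifferentiableAt 𝓘(ℝ, E4) 𝓘(ℝ, E4) (FH : E4 → Cap R₁) w ∧ ∀ u : E4,
      mfderiv 𝓘(ℝ, E4) 𝓘(ℝ, E4) (FH : E4 → Cap R₁) w u =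
        mfderiv 𝓘(ℝ, E4) 𝓘(ℝ, E4) (κH : OH R₁ → Cap R₁) (mkH (inv2 w)) (fderiv ℝ inv2 w u) := by
  obtain ⟨hd, he⟩ := mfderiv_mkH_inv2 h2
  have hκ := mdifferentiableAt_κH (R₁ := R₁) (mkH (inv2 w))
  refine ⟨hκ.comp w hd, fun u => ?_⟩
  rw [FH, mfderiv_comp w hκ hd]
  show mfderiv 𝓘(ℝ, E4) 𝓘(ℝ, E4) κH (mkH (inv2 w)) (mfderiv 𝓘(ℝ, E4) 𝓘(ℝ, E4)
    (toOpens (OH R₁) oH ∘ inv2) w u) = _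
  rw [he]

/-- **`FV^* βCap = ΩM`** at points with `|z₁| > R₁`. [folklore] -/
theorem βCap_pullback_FV {w : E4} (h1 : R₁ ^ 2 < r1 w) : (βCap R₁).pullback 𝓘(ℝ, E4) FV w = ΩM R₁ w := by
  obtain ⟨hd, -⟩ := mfderiv_mkV_inv1 h1
  have hm : inv1 w ∈ OV R₁ := r1_inv1_lt hR.out h1
  rw [FV, pullback_comp_pt _ (mdifferentiableAt_κV _) hd, pullback_congr_form (βCap_pullback_κV _), βV,
    ← pullback_comp_pt _ (Literature.Geometry.Manifold.OpenSubmanifold.mdifferentiableAt_subtype_val _) hd]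
  have hev : (Subtype.val ∘ (toOpens (OV R₁) oV ∘ inv1)) =ᶠ[𝓝 w] inv1 := by
    have hc : ContinuousAt inv1 w := (contDiffAt_inv1 (r1_ne_zero_of_sq_lt h1)).continuousAt
    filter_upwards [hc.preimage_mem_nhds ((OV R₁).2.mem_nhds hm)] with w' hw'
    exact val_toOpens hw'
  rw [pullback_congr_map _ hev, ΩV_pullback_inv1 R₁ (r1_ne_zero_of_sq_lt h1)]

/-- **`FH^* βCap = ΩM`** at points with `|z₂| > R₁`. [folklore] -/
theorem βCap_pullback_FH {w : E4} (h2 : R₁ ^ 2 < r2 w) : (βCap R₁).pullback 𝓘(ℝ, E4) FH w = ΩM R₁ w := by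
  obtain ⟨hd, -⟩ := mfderiv_mkH_inv2 h2
  have hm : inv2 w ∈ OH R₁ := r2_inv2_lt hR.out h2
  rw [FH, pullback_comp_pt _ (mdifferentiableAt_κH _) hd, pullback_congr_form (βCap_pullback_κH _), βH,
    ← pullback_comp_pt _ (Literature.Geometry.Manifold.OpenSubmanifold.mdifferentiableAt_subtype_val _) hd]
  have hev : (Subtype.val ∘ (toOpens (OH R₁) oH ∘ inv2)) =ᶠ[𝓝 w] inv2 := by
    have hc : ContinuousAt inv2 w := (contDiffAt_inv2 (r2_ne_zero_of_sq_lt h2)).continuousAt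
    filter_upwards [hc.preimage_mem_nhds ((OH R₁).2.mem_nhds hm)] with w' hw'
    exact val_toOpens hw'
  rw [pullback_congr_map _ hev, ΩH_pullback_inv2 R₁ (r2_ne_zero_of_sq_lt h2)]

/-! ## Holomorphy and consistency of the gluing `M ⇀ Cap` -/

variable {M : Type} [TopologicalSpace M] [T2Space M] [ChartedSpace E4 M] [IsManifold (𝓡 4) ∞ M]
  {sf : MForm (𝓡 4) M ℝ 2} {K : Set M} {R : ℝ} {ψ : M → E4} {χ : E4 → M}
  {J : AlmostComplexStructure (𝓡 4) ∞ M} (H : EndHyp sf K R ψ χ R₁ J)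

/-- The gluing map near a point with `|ψ₁| > R₁` is `FV ∘ ψ`; its differential. [folklore] -/
theorem mfderiv_glue_of_r1 {x : M} (hK : x ∉ K) (h1 : R₁ ^ 2 < r1 (ψ x)) (u : TangentSpace (𝓡 4) x) :
    mfderiv (𝓡 4) 𝓘(ℝ, E4) (dX H).glue x u = mfderiv 𝓘(ℝ, E4) 𝓘(ℝ, E4) (κV : OV R₁ → Cap R₁)
      (mkV (inv1 (ψ x))) (fderiv ℝ inv1 (ψ x) (mfderiv (𝓡 4) 𝓘(ℝ, E4) ψ x u)) := by
  have hψ := H.contMDiffAt_ψ hK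
  have hev : ((dX H).glue : M → Cap R₁) =ᶠ[𝓝 x] (FV ∘ ψ) :=
    hψ.continuousAt.eventually (ofCoord_eventuallyEq_FV h1) |>.mono fun x' h => by
      rw [dX_glue_apply]; exact h
  obtain ⟨hd, he⟩ := mfderiv_FV (R₁ := R₁) h1
  rw [hev.mfderiv_eq, mfderiv_comp x hd (hψ.mdifferentiableAt (by simp))]
  exact he _

/-- The gluing map near a point with `|ψ₂| > R₁` is `FH ∘ ψ`; its differential. [folklore] -/
theorem mfderiv_glue_of_r2 {x : M} (hK : x ∉ K) (h2 : R₁ ^ 2 < r2 (ψ x)) (u : TangentSpace (𝓡 4) x) :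
    mfderiv (𝓡 4) 𝓘(ℝ, E4) (dX H).glue x u = mfderiv 𝓘(ℝ, E4) 𝓘(ℝ, E4) (κH : OH R₁ → Cap R₁)
      (mkH (inv2 (ψ x))) (fderiv ℝ inv2 (ψ x) (mfderiv (𝓡 4) 𝓘(ℝ, E4) ψ x u)) := by
  have hψ := H.contMDiffAt_ψ hK
  have hev : ((dX H).glue : M → Cap R₁) =ᶠ[𝓝 x] (FH ∘ ψ) :=
    hψ.continuousAt.eventually (ofCoord_eventuallyEq_FH h2) |>.mono fun x' h => by
      rw [dX_glue_apply]; exact h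
  obtain ⟨hd, he⟩ := mfderiv_FH (R₁ := R₁) h2
  rw [hev.mfderiv_eq, mfderiv_comp x hd (hψ.mdifferentiableAt (by simp))]
  exact he _

/-- **The gluing `M ⇀ Cap` is `(J, JCap)`-holomorphic.** [folklore] -/
theorem hol_X : ∀ x ∈ (dX H).glue.source, ∀ v : E4,
    mfderiv (𝓡 4) 𝓘(ℝ, E4) (dX H).glue x (J x v) =
      JCap R₁ ((dX H).glue x) (mfderiv (𝓡 4) 𝓘(ℝ, E4) (dX H).glue x v) := by
  rintro x ⟨hK, hg⟩ v
  have hK' : x ∉ K := hK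
  rcases hg with h1 | h2
  · rw [mfderiv_glue_of_r1 H hK' h1, mfderiv_glue_of_r1 H hK' h1,
      mfderiv_ψ_J H hK' (H.lt_norm_of_r1 h1).1, fderiv_inv1_I4 (r1_ne_zero_of_sq_lt h1), ← JCap_κV]
    exact acs_congr_point _ (by rw [dX_glue_apply, ofCoord_of_r1 h1]) _
  · rw [mfderiv_glue_of_r2 H hK' h2, mfderiv_glue_of_r2 H hK' h2,
      mfderiv_ψ_J H hK' (H.lt_norm_of_r2 h2).1, fderiv_inv2_I4 (r2_ne_zero_of_sq_lt h2), ← JCap_κH]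
    exact acs_congr_point _ (by rw [dX_glue_apply, ofCoord_of_r2 h2]) _

/-- **The gluing pulls the cap form back to the modified form.** [folklore] -/
theorem compat_X : ∀ x ∈ (dX H).glue.source,
    (βCap R₁).pullback (𝓡 4) (dX H).glue x = sfMod H x := by
  rintro x ⟨hK, hg⟩
  have hK' : x ∉ K := hK
  have hψ := H.contMDiffAt_ψ hK'
  rw [sfMod_of_not_mem H hK']
  rcases hg with h1 | h2
  · have hev : ((dX H).glue : M → Cap R₁) =ᶠ[𝓝 x] (FV ∘ ψ) :=
      hψ.continuousAt.eventually (ofCoord_eventuallyEq_FV h1) |>.mono fun x' h => by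
        rw [dX_glue_apply]; exact h
    rw [pullback_congr_map _ hev, pullback_comp_pt _ (mfderiv_FV h1).1 (hψ.mdifferentiableAt (by simp))]
    exact pullback_congr_form (βCap_pullback_FV h1)
  · have hev : ((dX H).glue : M → Cap R₁) =ᶠ[𝓝 x] (FH ∘ ψ) :=
      hψ.continuousAt.eventually (ofCoord_eventuallyEq_FH h2) |>.mono fun x' h => by
        rw [dX_glue_apply]; exact h
    rw [pullback_congr_map _ hev, pullback_comp_pt _ (mfderiv_FH h2).1 (hψ.mdifferentiableAt (by simp))]
    exact pullback_congr_form (βCap_pullback_FH h2)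

/-! ## `JX`, `ωX` -/

variable [Nonempty M]

/-- **The almost complex structure of `X`** (`J` on `M`, `JCap` on the cap). [folklore] -/
def JX : AlmostComplexStructure (𝓡 4) ∞ (dX H).Glued := GlueJ.glueACS (dX H) J (JCap R₁) (hol_X H)

/-- **The form of `X`** (`sfMod` on `M`, `βCap` on the cap). [folklore] -/
def ωX : MForm (𝓡 4) (dX H).Glued ℝ 2 := GlueF.glueForm (dX H) (sfMod H) (βCap R₁)

/-- **`ωX` is smooth, closed and tames `JX`.** [folklore] -/
theorem ωX_props : IsSmoothForm (ωX H) ∧ IsClosedForm (ωX H) ∧ (JX H).IsTamedBy (ωX H) := by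
  obtain ⟨hCs, hCc, hCt⟩ := βCap_smooth_closed_tame (R₁ := R₁)
  exact ⟨GlueF.isSmoothForm_glueForm _ (compat_X H) (isSmoothForm_sfMod H) hCs,
    GlueF.isClosedForm_glueForm _ (compat_X H) (isSmoothForm_sfMod H) hCs (isClosedForm_sfMod H) hCc,
    GlueF.glueForm_tames _ (compat_X H) (hol_X H) (tame_sfMod H) hCt⟩

end CapModel

/-- **Registered helper sub-goal `helper_capModelTameModel`** (file `X5` of stub `stub_capModel`): under the
hypotheses of the stub, the closed model carries a closed smooth `2`-form taming an almost complex structure extending `J`. [folklore] -/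
theorem helper_capModelTameModel :
    ∀ (M : Type) [TopologicalSpace M] [T2Space M] [SecondCountableTopology M]
      [ChartedSpace (EuclideanSpace ℝ (Fin 4)) M] [IsManifold (𝓡 4) ∞ M] [ConnectedSpace M]
      (sf : Literature.Geometry.Kaehler.MForm (𝓡 4) M ℝ 2) (K : Set M) (R : ℝ)
      (ψ : M → EuclideanSpace ℝ (Fin 4)) (χ : EuclideanSpace ℝ (Fin 4) → M),
      Literature.Geometry.Kaehler.IsSmoothForm sf → Literature.Geometry.Kaehler.IsClosedForm sf →
      (∀ x (v : TangentSpace (𝓡 4) x), v ≠ 0 → ∃ w, sf x ![v, w] ≠ 0) →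
      (∀ R', R ≤ R' → IsCompact (K ∪ {x | ‖ψ x‖ ≤ R'})) →
      ContMDiffOn (𝓡 4) 𝓘(ℝ, EuclideanSpace ℝ (Fin 4)) ∞ ψ Kᶜ →
      ContMDiffOn 𝓘(ℝ, EuclideanSpace ℝ (Fin 4)) (𝓡 4) ∞ χ
        (Metric.closedBall (0 : EuclideanSpace ℝ (Fin 4)) R)ᶜ →
      Set.BijOn ψ Kᶜ (Metric.closedBall (0 : EuclideanSpace ℝ (Fin 4)) R)ᶜ →
      (∀ x, x ∈ Kᶜ → χ (ψ x) = x) →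
      (∀ x, x ∈ Kᶜ → ∀ v w, sf x ![v, w] = Literature.Geometry.Symplectic.stdSymplecticForm
        (mfderiv (𝓡 4) 𝓘(ℝ, EuclideanSpace ℝ (Fin 4)) ψ x v)
        (mfderiv (𝓡 4) 𝓘(ℝ, EuclideanSpace ℝ (Fin 4)) ψ x w)) →
      (∀ R', R < R' → IsOpen (K ∪ {x | x ∈ Kᶜ ∧ ‖ψ x‖ < R'})) →
      ∀ (R₁ : ℝ) (J : Literature.Geometry.Symplectic.AlmostComplexStructure (𝓡 4) ∞ M),
      R < R₁ → 0 < R₁ → J.IsTamedBy sf →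
      (∀ x, x ∈ Kᶜ → R₁ < ‖ψ x‖ → ∀ (v : TangentSpace (𝓡 4) x) (a : EuclideanSpace ℝ (Fin 4)),
          a = mfderiv (𝓡 4) 𝓘(ℝ, EuclideanSpace ℝ (Fin 4)) ψ x v →
          mfderiv (𝓡 4) 𝓘(ℝ, EuclideanSpace ℝ (Fin 4)) ψ x (J x v) =
            WithLp.toLp 2 ![-(a 1), a 0, -(a 3), a 2]) →
      ∃ (X : Type) (_ : TopologicalSpace X) (_ : T2Space X) (_ : SecondCountableTopology X)
        (_ : CompactSpace X) (_ : ConnectedSpace X) (_ : ChartedSpace (EuclideanSpace ℝ (Fin 4)) X)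
        (_ : IsManifold (𝓡 4) ∞ X) (ωX : Literature.Geometry.Kaehler.MForm (𝓡 4) X ℝ 2)
        (JX : Literature.Geometry.Symplectic.AlmostComplexStructure (𝓡 4) ∞ X) (ι : M → X),
        (Literature.Geometry.Kaehler.IsSmoothForm ωX ∧ Literature.Geometry.Kaehler.IsClosedForm ωX ∧
          JX.IsTamedBy ωX) ∧
        (IsLocalDiffeomorph (𝓡 4) (𝓡 4) ∞ ι ∧ Function.Injective ι ∧
          ∀ (x : M) (v : TangentSpace (𝓡 4) x),
            JX (ι x) (mfderiv (𝓡 4) (𝓡 4) ι x v) = mfderiv (𝓡 4) (𝓡 4) ι x (J x v)) := by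
  intro M _ _ _ _ _ _ sf K R ψ χ h2 h3 h4 h5 h6 h7 h8 h9 h10 hopen R₁ J hR₁ hR₁pos hJt hJstd
  haveI : Fact (0 < R₁) := ⟨hR₁pos⟩
  let H : CapModel.EndHyp sf K R ψ χ R₁ J :=
    { smooth := h2, closed := h3, nondeg := h4, ends := h5, smooth_ψ := h6, smooth_χ := h7, bij := h8,
      left_inv := h9, pullback_eq := h10, isOpen_trunc := hopen, lt_R₁ := hR₁, R₁_pos := hR₁pos,
      tame := hJt, Jstd := hJstd }
  exact ⟨(CapModel.dX H).Glued, inferInstance, CapModel.t2Space_X H, CapModel.secondCountable_X H,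
    CapModel.compactSpace_X H, CapModel.connectedSpace_X H, inferInstance, inferInstance,
    CapModel.ωX H, CapModel.JX H, (CapModel.dX H).inl, CapModel.ωX_props H,
    CapModel.isLocalDiffeomorph_of_emb (CapModel.dX H).isSmoothEmbedding_inl (CapModel.dX H).isOpen_range_inl,
    (CapModel.dX H).inl_injective, fun x v => CapModel.GlueJ.glueACS_inl (CapModel.dX H) x v⟩

end Summit.SmoothPoincare4.SmoothPoincare4.Theorems.GromovRecognitionRelEnd.CrossCapLaurent
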